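import Summits.AnomalousDissipation.AnomalousDissipation.Theses.PointSink
import Summits.AnomalousDissipation.AnomalousDissipation.Theorems.PointSinkConeDesingularisationStubEnvelopeOfFarField
import Summits.AnomalousDissipation.AnomalousDissipation.Theorems.PointSinkConeDesingularisationStubDissipationPosOfFarField

/-!
# Negative knowledge for the crux `ConeDesingularisation` (stmt-AnomalousDissipation-19034, route PointSink):
# IV. The `L^p` escape — a field with the Galdi-critical shell-mass floor lies in NO `L^p(ℝ³)`, `2 ≤ p ≤ 9/2`

Certified copy of §2c of the cdisprove work file `Cruxes/ConeDesingularisation/Disproof.lean`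
(refuter-cdisprove-stmt-AnomalousDissipation-19034-0, cycle 1). Supports stmt-AnomalousDissipation-19034;
nothing here asserts a Theses decl positively.

`not_memLp_of_shell_mass_floor`: if a continuous `Q : ℝ³ → ℝ³` satisfies the shell-mass floor
`(λ^k)^{5/3} c ≤ ∫_{λ^k<‖x‖<λ^{k+1}} ‖Q‖²` eventually (`λ > 1`, `c > 0`) — which every cascade soliton does,
by `Negative/FarFieldMass.shell_mass_floor` — then `Q ∉ L^p(ℝ³)` for every `2 ≤ p ≤ 9/2`. Proof: if
`Q ∈ L^p` the shell integrals `∫_{shell k}‖Q‖^p` are tails of a convergent integral and tend to `0`, while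
Hölder on the shell (volume `(λ^k)³ |shell 0|`) gives
`∫_{shell k}‖Q‖² ≤ (∫_{shell k}‖Q‖^p)^{2/p} ((λ^k)³|shell 0|)^{1−2/p}` with `3(1 − 2/p) ≤ 5/3` exactly when
`p ≤ 9/2`. The endpoint `p = 9/2` is Galdi's exponent: the tree's `galdi_liouville_nineHalves`
(Galdi 2011 Thm X.9.5, `u ∈ L^{9/2} ⇒ u ≡ 0`) can never be applied to the conclusion of the crux, and neither
can any criterion through `L^p`, `p ≤ 9/2` (e.g. `L³`-smallness of Seregin–Wang / Tsai type needs the annular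
`L³` mass SMALL, whereas here `R^{-1}∫_{R<‖x‖<λR}‖Q‖³` is bounded BELOW).
-/

noncomputable section

-- `Summit.<Summit>.<Problem>`: single-conjunct summit, the duplicate namespace is mandated (CONVENTIONS §2).
set_option linter.dupNamespace false

open MeasureTheory Filter Topology Set
open scoped Pointwise ENNReal
open Literature.Analysis.FunctionSpaces Literature.Analysis.FluidPDE

namespace Summit.AnomalousDissipation.AnomalousDissipation.Theorems.ConeDesingularisation.Negative

open Summit.AnomalousDissipation.AnomalousDissipation.Theorems
  (coneEnvelope_smul_shell coneDissip_volumeReal_shell_pos coneDissip_volume_shell_lt_top coneDissip_isOpen_shell)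

/-- Volume of the `k`-th DSS shell: `|{λ^k < ‖x‖ < λ^{k+1}}| = (λ^k)³ |{1 < ‖x‖ < λ}|`. [folklore] -/
theorem volume_real_shell_pow {lam : ℝ} (hlam : 0 < lam) (k : ℕ) :
    volume.real {x : EuclideanSpace ℝ (Fin 3) | lam ^ k < ‖x‖ ∧ ‖x‖ < lam ^ (k + 1)} =
      (lam ^ k) ^ 3 * volume.real {x : EuclideanSpace ℝ (Fin 3) | 1 < ‖x‖ ∧ ‖x‖ < lam} := by
  have hLk : 0 < lam ^ k := pow_pos hlam k
  have hset : {x : EuclideanSpace ℝ (Fin 3) | lam ^ k < ‖x‖ ∧ ‖x‖ < lam ^ (k + 1)} =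
      (lam ^ k) • {x : EuclideanSpace ℝ (Fin 3) | 1 < ‖x‖ ∧ ‖x‖ < lam} := by
    rw [coneEnvelope_smul_shell lam hLk, ← pow_succ]
  rw [hset, measureReal_def, measureReal_def, Measure.addHaar_smul, finrank_euclideanSpace_fin,
    ENNReal.toReal_mul, ENNReal.toReal_ofReal (abs_nonneg _), abs_of_pos (pow_pos hLk 3)]

/-- **The `L^p` escape.** A continuous field with the Galdi-critical shell-mass floor
`(λ^k)^{5/3} c ≤ ∫_{λ^k<‖x‖<λ^{k+1}} ‖Q‖²` (eventually in `k`; `λ > 1`, `c > 0`) belongs to NO `L^p(ℝ³)`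
with `2 ≤ p ≤ 9/2`. In particular (with `Negative/FarFieldMass.shell_mass_floor`) a cascade soliton is in
no such `L^p`, and Galdi's `L^{9/2}` Liouville theorem cannot bite the conclusion of the crux. [folklore] -/
theorem not_memLp_of_shell_mass_floor {lam : ℝ}
    {Q : EuclideanSpace ℝ (Fin 3) → EuclideanSpace ℝ (Fin 3)} (hlam : 1 < lam) (hQ : Continuous Q)
    {c : ℝ} (hc : 0 < c)
    (hfloor : ∀ᶠ k : ℕ in atTop, (lam ^ k) ^ (5 / 3 : ℝ) * c ≤
      ∫ x in {x : EuclideanSpace ℝ (Fin 3) | lam ^ k < ‖x‖ ∧ ‖x‖ < lam ^ (k + 1)}, ‖Q x‖ ^ 2)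
    {p : ℝ} (hp2 : 2 ≤ p) (hp : p ≤ 9 / 2) : ¬ MemLp Q (ENNReal.ofReal p) volume := by
  intro hmem
  have hlam0 : 0 < lam := by linarith
  have hp0 : 0 < p := by linarith
  -- `‖Q‖^p` is integrable
  have hint : Integrable (fun x => ‖Q x‖ ^ p) volume := by
    have h := hmem.integrable_norm_rpow (by simp [hp0]) ENNReal.ofReal_ne_top
    simpa [ENNReal.toReal_ofReal hp0.le] using h
  -- the tails `∫_{λ^k < ‖x‖} ‖Q‖^p` tend to `0`
  set S : ℕ → Set (EuclideanSpace ℝ (Fin 3)) := fun k => {x | lam ^ k < ‖x‖} with hS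
  have hSm : ∀ k, MeasurableSet (S k) := fun k =>
    (isOpen_lt continuous_const continuous_norm).measurableSet
  have hanti : Antitone S := fun k l hkl x hx =>
    lt_of_le_of_lt (pow_le_pow_right₀ hlam.le hkl) hx
  have hInter : (⋂ k, S k) = ∅ := by
    ext x
    simp only [mem_iInter, mem_empty_iff_false, iff_false, not_forall, hS, mem_setOf_eq, not_lt]
    obtain ⟨k, hk⟩ := pow_unbounded_of_one_lt ‖x‖ hlam
    exact ⟨k, hk.le⟩
  have htail : Tendsto (fun k => ∫ x in S k, ‖Q x‖ ^ p) atTop (𝓝 0) := by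
    have h := tendsto_setIntegral_of_antitone hSm hanti ⟨0, hint.integrableOn⟩
    simpa [hInter] using h
  -- hence the shell integrals `ε k = ∫_{shell k} ‖Q‖^p` tend to `0`
  have hε : Tendsto (fun k : ℕ =>
      ∫ x in {x : EuclideanSpace ℝ (Fin 3) | lam ^ k < ‖x‖ ∧ ‖x‖ < lam ^ (k + 1)}, ‖Q x‖ ^ p)
      atTop (𝓝 0) := by
    refine tendsto_of_tendsto_of_tendsto_of_le_of_le tendsto_const_nhds htail (fun k => ?_) fun k => ?_
    · exact integral_nonneg fun x => by positivity
    · exact setIntegral_mono_set hint.integrableOn (ae_of_all _ fun x => by positivity)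
        (ae_of_all _ fun x hx => hx.1)
  -- Hölder on each shell: `∫‖Q‖² ≤ ε_k^{2/p} ((λ^k)³ v₀)^{1-2/p}` (for `p > 2`; trivial for `p = 2`)
  set v₀ : ℝ := volume.real {x : EuclideanSpace ℝ (Fin 3) | 1 < ‖x‖ ∧ ‖x‖ < lam} with hv₀
  have hv₀pos : 0 < v₀ := coneDissip_volumeReal_shell_pos hlam
  have hholder : ∀ k : ℕ,
      ∫ x in {x : EuclideanSpace ℝ (Fin 3) | lam ^ k < ‖x‖ ∧ ‖x‖ < lam ^ (k + 1)}, ‖Q x‖ ^ 2 ≤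
        (∫ x in {x : EuclideanSpace ℝ (Fin 3) | lam ^ k < ‖x‖ ∧ ‖x‖ < lam ^ (k + 1)}, ‖Q x‖ ^ p) ^ (2 / p) *
          ((lam ^ k) ^ 3 * v₀) ^ (1 - 2 / p) := by
    intro k
    have hLk : 0 < lam ^ k := pow_pos hlam0 k
    set A : Set (EuclideanSpace ℝ (Fin 3)) :=
      {x : EuclideanSpace ℝ (Fin 3) | lam ^ k < ‖x‖ ∧ ‖x‖ < lam ^ (k + 1)} with hA
    have hAfin : volume A < ⊤ :=
      (measure_mono fun x hx => mem_ball_zero_iff.2 hx.2).trans_lt measure_ball_lt_top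
    have hAvol : volume.real A = (lam ^ k) ^ 3 * v₀ := volume_real_shell_pow hlam0 k
    haveI : IsFiniteMeasure (volume.restrict A) := isFiniteMeasure_restrict.2 hAfin.ne
    rcases eq_or_lt_of_le hp2 with h2 | h2
    · -- p = 2: the Hölder factor is `1`
      subst h2
      have h1 : (2 : ℝ) / 2 = 1 := by norm_num
      rw [h1, Real.rpow_one, sub_self, Real.rpow_zero, mul_one]
      refine le_of_eq (integral_congr_ae (ae_of_all _ fun x => ?_))
      simp
    · -- p > 2: Hölder with exponents `p/2` and `(p/2)' = p/(p-2)` against the constant `1`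
      have hP : 1 < p / 2 := by linarith
      have hpq := Real.HolderConjugate.conjExponent hP
      -- `Q` is bounded on the shell
      obtain ⟨B, hB⟩ := (isCompact_closedBall (0 : EuclideanSpace ℝ (Fin 3)) (lam ^ (k + 1))).exists_bound_of_continuousOn
        hQ.continuousOn
      have hbound : ∀ᵐ x ∂(volume.restrict A), (fun x => ‖Q x‖ ^ 2) x ∈ Set.Icc 0 (B ^ 2) := by
        filter_upwards [ae_restrict_mem (measurableSet_lt measurable_const measurable_norm |>.inter
          (measurableSet_lt measurable_norm measurable_const))] with x hx
        have hxB : ‖Q x‖ ≤ B := hB x (mem_closedBall_zero_iff.2 hx.2.le)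
        exact ⟨sq_nonneg _, pow_le_pow_left₀ (norm_nonneg _) hxB 2⟩
      have hf : MemLp (fun x => ‖Q x‖ ^ 2) (ENNReal.ofReal (p / 2)) (volume.restrict A) :=
        memLp_of_bounded hbound (hQ.norm.pow 2).aestronglyMeasurable _
      have hg : MemLp (fun _ : EuclideanSpace ℝ (Fin 3) => (1 : ℝ)) (ENNReal.ofReal (p / 2).conjExponent)
          (volume.restrict A) := memLp_const 1
      have h := integral_mul_le_Lp_mul_Lq_of_nonneg hpq (ae_of_all _ fun x => sq_nonneg ‖Q x‖)
        (ae_of_all _ fun _ => zero_le_one) hf hg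
      simp only [mul_one, Real.one_rpow, integral_const, smul_eq_mul] at h
      -- rewrite `(‖Q‖²)^{p/2} = ‖Q‖^p`, `1/(p/2) = 2/p`, `1/(p/2)' = 1 - 2/p`, `|A| = (λ^k)³ v₀`
      have hpow : ∀ x : EuclideanSpace ℝ (Fin 3), (‖Q x‖ ^ 2) ^ (p / 2) = ‖Q x‖ ^ p := fun x => by
        have h2p : ((2 : ℕ) : ℝ) * (p / 2) = p := by push_cast; ring
        rw [← Real.rpow_natCast, ← Real.rpow_mul (norm_nonneg _), h2p]
      have hexp1 : 1 / (p / 2) = 2 / p := by field_simp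
      have hexp2 : 1 / (p / 2).conjExponent = 1 - 2 / p := by
        rw [Real.conjExponent]
        field_simp
      simp_rw [hpow] at h
      rw [hexp1, hexp2, measureReal_restrict_apply_univ, hAvol] at h
      exact h
  -- combine with the floor: `c ≤ ε_k^{2/p} v₀^{1-2/p}` eventually, since `3(1-2/p) ≤ 5/3`
  have hkey : ∀ᶠ k : ℕ in atTop, c ≤
      (∫ x in {x : EuclideanSpace ℝ (Fin 3) | lam ^ k < ‖x‖ ∧ ‖x‖ < lam ^ (k + 1)}, ‖Q x‖ ^ p) ^ (2 / p) *
        v₀ ^ (1 - 2 / p) := by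
    filter_upwards [hfloor] with k hk
    have hLk : 0 < lam ^ k := pow_pos hlam0 k
    have hL1 : 1 ≤ lam ^ k := one_le_pow₀ hlam.le
    have hL53 : 0 < (lam ^ k) ^ (5 / 3 : ℝ) := Real.rpow_pos_of_pos hLk _
    have hεk : 0 ≤ (∫ x in {x : EuclideanSpace ℝ (Fin 3) | lam ^ k < ‖x‖ ∧ ‖x‖ < lam ^ (k + 1)},
        ‖Q x‖ ^ p) ^ (2 / p) := Real.rpow_nonneg (integral_nonneg fun x => by positivity) _
    -- `((λ^k)³ v₀)^{1-2/p} = (λ^k)^{3(1-2/p)} v₀^{1-2/p} ≤ (λ^k)^{5/3} v₀^{1-2/p}`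
    have hsplit : ((lam ^ k) ^ 3 * v₀) ^ (1 - 2 / p) = (lam ^ k) ^ (3 * (1 - 2 / p)) * v₀ ^ (1 - 2 / p) := by
      rw [Real.mul_rpow (pow_nonneg hLk.le 3) hv₀pos.le, ← Real.rpow_natCast (lam ^ k) 3,
        ← Real.rpow_mul hLk.le]
      norm_num
    have hexp : (lam ^ k) ^ (3 * (1 - 2 / p)) ≤ (lam ^ k) ^ (5 / 3 : ℝ) := by
      refine Real.rpow_le_rpow_of_exponent_le hL1 ?_
      have : 2 / p ≥ 2 / (9 / 2) := div_le_div_of_nonneg_left (by norm_num) hp0 hp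
      linarith
    have h1 := hk.trans (hholder k)
    rw [hsplit] at h1
    have h2 : (∫ x in {x : EuclideanSpace ℝ (Fin 3) | lam ^ k < ‖x‖ ∧ ‖x‖ < lam ^ (k + 1)}, ‖Q x‖ ^ p) ^ (2 / p) *
        ((lam ^ k) ^ (3 * (1 - 2 / p)) * v₀ ^ (1 - 2 / p)) ≤
        (∫ x in {x : EuclideanSpace ℝ (Fin 3) | lam ^ k < ‖x‖ ∧ ‖x‖ < lam ^ (k + 1)}, ‖Q x‖ ^ p) ^ (2 / p) *
        ((lam ^ k) ^ (5 / 3 : ℝ) * v₀ ^ (1 - 2 / p)) :=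
      mul_le_mul_of_nonneg_left (mul_le_mul_of_nonneg_right hexp (Real.rpow_nonneg hv₀pos.le _)) hεk
    have h3 := h1.trans h2
    -- divide by `(λ^k)^{5/3} > 0`
    have h4 : (lam ^ k) ^ (5 / 3 : ℝ) * c ≤ (lam ^ k) ^ (5 / 3 : ℝ) *
        ((∫ x in {x : EuclideanSpace ℝ (Fin 3) | lam ^ k < ‖x‖ ∧ ‖x‖ < lam ^ (k + 1)}, ‖Q x‖ ^ p) ^ (2 / p) *
          v₀ ^ (1 - 2 / p)) := by
      calc (lam ^ k) ^ (5 / 3 : ℝ) * c ≤ _ := h3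
        _ = _ := by ring
    exact le_of_mul_le_mul_left h4 hL53
  -- but the right-hand side tends to `0`
  have hlim : Tendsto (fun k : ℕ =>
      (∫ x in {x : EuclideanSpace ℝ (Fin 3) | lam ^ k < ‖x‖ ∧ ‖x‖ < lam ^ (k + 1)}, ‖Q x‖ ^ p) ^ (2 / p) *
        v₀ ^ (1 - 2 / p)) atTop (𝓝 0) := by
    have h1 : Tendsto (fun k : ℕ =>
        (∫ x in {x : EuclideanSpace ℝ (Fin 3) | lam ^ k < ‖x‖ ∧ ‖x‖ < lam ^ (k + 1)}, ‖Q x‖ ^ p) ^ (2 / p))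
        atTop (𝓝 0) := by
      have h := hε.rpow_const (p := 2 / p) (Or.inr (by positivity))
      rwa [Real.zero_rpow (by positivity)] at h
    simpa using h1.mul_const (v₀ ^ (1 - 2 / p))
  have hsmall : ∀ᶠ k : ℕ in atTop,
      (∫ x in {x : EuclideanSpace ℝ (Fin 3) | lam ^ k < ‖x‖ ∧ ‖x‖ < lam ^ (k + 1)}, ‖Q x‖ ^ p) ^ (2 / p) *
        v₀ ^ (1 - 2 / p) < c := (tendsto_order.1 hlim).2 _ hc
  obtain ⟨k, hk1, hk2⟩ := (hkey.and hsmall).exists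
  linarith

end Summit.AnomalousDissipation.AnomalousDissipation.Theorems.ConeDesingularisation.Negative

end
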